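import Summits.RiemannHypothesis.RiemannHypothesis.Theorems.Splittings.BombieriTruncExp256
import Summits.RiemannHypothesis.RiemannHypothesis.Theorems.Splittings.MassAwareSamplingCeilingA
import HarnessLib

/-!
# x-wuc GEN-11 row ★₁₀₂₄ʳ — `HSW → K1′ → (RH ⟺ RH(e^1024) ∧ B′₁([−1,1]))` — tree port, part A (1/4)

Port lane of item stmt-RiemannHypothesis-23478 `XWucRLadder.StarRowExp1024` (L9 «X-WUC R-LADDER», support; director ORDER (II),
lead g9 RULINGS #359/#360/#365; filer rh-split-typer-5).  Source: `run/shared/lean/pub/rh-split/rh-split-x-wuc/SplitXWucG11b.lean`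
(sha16 3a3eefe13ea0264d, seat rh-split-x-wuc g11, card `cards/SPLIT-x-wuc.md` §17a), theorem
`XWucG8.rh_iff_rhUpTo_exp1024_and_boundedAwayAt_of_kCertLR` (0.042 ≤ θ).  Of the 96 declarations in its reference closure, 65 are
ALREADY tree theorems under `…Splittings.BombieriTruncMassAware` (modules BombieriTruncMassAware / ScreenAbove / MassSampling /
OrdinateBand / OrdinateCount / Exp256) and `…Splittings.MassAwareSamplingCeiling` (MassAwareSamplingCeilingA), and 8 (+ `CertBodyR`,
`KCertLR`) are in the K1R port (`Splittings/SplitXWucK1R*.lean`, typer-4); this chain ports ONLY the 23 residual declarations, VERBATIM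
and in order, RE-TARGETED onto those tree twins (namespace `…XWucG8` kept, the two tree namespaces opened; parts A/B import no K1R
part so that `Phi`/`key`/`hkap`/`zdens`/`hwt` denote the tree's `BombieriTruncMassAware` objects exactly as the tree lemmas expect).
Deltas: insert-only docstrings where missing; ONE bridge line in part D (`BombieriTruncMassAware.Phi = XWucG8.Phi` by `rfl`).
Part A (this file): the capped HELPER / ORDINATE BANDS `HelperBandL`, `OrdinateBandL`, the screening reduction
`offLineScreenedAboveAt_of_helperBandL` (T8c_L), `helperBandL_of_ordinateBandL`, and rows `rh_iff_rhUpTo_and_boundedAwayAt_of_samplingL`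
/ `_of_ordinateBandL`.  CONDITIONAL bookkeeping (rows modulo the conjectural sampling node / K-CERT′ and the print fact HSW);
RH is not proved by this.  HONEST LABEL: «SPLITTING SEARCH over kernel-typed RH-EQUIVALENCES; a splitting A ∧ B ⟹ RH is CONDITIONAL bookkeeping unless A and B are both proved; nothing here bears on the truth of RH.»
-/

-- D-0017: `Summit.RiemannHypothesis.RiemannHypothesis.…` duplicates the namespace BY DESIGN (single-problem summit).
set_option linter.dupNamespace false
noncomputable section

namespace Summit.RiemannHypothesis.RiemannHypothesis.Theorems.Splittings.XWucG8

open scoped Classical ComplexConjugate InnerProductSpace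
open Set Filter Topology Complex MeasureTheory
open Literature.NumberTheory.LFunctions Literature.NumberTheory.LFunctions.Bombieri2000
open Summit.RiemannHypothesis.RiemannHypothesis.Theses.RuelleBand
open Summit.RiemannHypothesis.RiemannHypothesis.Theorems.Splittings.BombieriTruncEigen
open Summit.RiemannHypothesis.RiemannHypothesis.Theorems.Splittings.BombieriFozNoDep
open Summit.RiemannHypothesis.RiemannHypothesis.Theorems.Splittings.BombieriTruncGram
open Summit.RiemannHypothesis.RiemannHypothesis.Theorems.Splittings.BombieriTruncPairing
open Summit.RiemannHypothesis.RiemannHypothesis.Theorems.Splittings.BombieriTruncScreening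
open Summit.RiemannHypothesis.RiemannHypothesis.Theorems.Splittings.BombieriTruncBandGap
open Summit.RiemannHypothesis.RiemannHypothesis.Theorems.Splittings.BombieriTruncMultiplicity
open Summit.RiemannHypothesis.RiemannHypothesis.Theorems.Splittings.BombieriTruncEventualStrip
open Summit.RiemannHypothesis.RiemannHypothesis.Theorems.Splittings.BombieriTruncExactness
open Summit.RiemannHypothesis.RiemannHypothesis.Theorems.Splittings.BombieriTruncClump
open Summit.RiemannHypothesis.RiemannHypothesis.Theorems.Splittings.BombieriTruncOffLineSparse
open Summit.RiemannHypothesis.RiemannHypothesis.Theorems.Splittings.BombieriTruncSynthesis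
open Summit.RiemannHypothesis.RiemannHypothesis.Theorems.Splittings.BombieriTruncSynthesisScreening
open Summit.RiemannHypothesis.RiemannHypothesis.Theorems.Splittings.BombieriTruncSynthesisRows
open Literature.NumberTheory.DiophantineGeometry (RiemannHypothesisUpTo)
open Summit.RiemannHypothesis.RiemannHypothesis.Theorems.Splittings.BombieriTruncMassAware
open Summit.RiemannHypothesis.RiemannHypothesis.Theorems.Splittings.MassAwareSamplingCeiling
variable {N : ℕ}

/-- **HELPER BAND above `T₀` at width `δ` with WINDOW CAP `L`**: `HelperBand` with `LocBand` replaced by `LocBandL L`.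
[new; typed hypothesis, discharged below from `OrdinateBandL L`] -/
def HelperBandL (L T₀ δ : ℝ) : Prop :=
  ∀ ρ ∈ ZetaZeros.riemannZetaNontrivialZeros, 1 / 2 < ρ.re → T₀ < ρ.im → ∀ Λ : ℝ, 0 < Λ → Λ ≤ ρ.im / (8 * Real.pi) →
    ∃ N₀ : ℕ, ∀ N : ℕ, N₀ ≤ N → ∃ j₀ : truncIdx N, (j₀ : ZeroIdx).val = ρ ∧
      ∃ (n : ℕ) (s : Fin n → truncIdx N),
        (∀ k l, ((s k : truncIdx N) : ZeroIdx).val = ((s l : truncIdx N) : ZeroIdx).val → k = l) ∧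
        (∀ k, ((s k : truncIdx N) : ZeroIdx).OffLine → 1 / 2 < ((s k : truncIdx N) : ZeroIdx).val.re) ∧
        (∀ k, ((s k : truncIdx N) : ZeroIdx).val ≠ (j₀ : ZeroIdx).val ∧
          ((s k : truncIdx N) : ZeroIdx).val ≠ ((tbar j₀ : truncIdx N) : ZeroIdx).val) ∧
        2 * ((fib j₀).card : ℝ) ≤ δ * zdens ρ.im ∧
        LocBandL L δ (zdens ρ.im) Λ (fun k ↦ tau (s k) - tau j₀) (fun k ↦ hwt (s k)) (2 * ((fib j₀).card : ℝ))

/-- **(T8c_L) OFF-LINE SCREENING ABOVE `T₀` AT LEVEL ONE from `MassAwareSamplingL L` + `HelperBandL L`** (G8.7 with the window cap as a parameter; proof verbatim).  If the ζ-free sampling lemma holds at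
`(δ, θ)` with `δ·Φ(κ₀) < 8πθ` for every decay `κ₀ ∈ (0, ½)`, and the zeros above `T₀ ≥ 2π·e^{2π}` obey the helper band at width `δ`, then
every off-line zero right of the line above `T₀` is screened at level `1`: `OffLineScreenedAboveAt T₀ 1` — hence rows X-7₁ / X-7₁/PT with
these hypotheses in place of the screening hypothesis.  [new; unconditional reduction] -/
theorem offLineScreenedAboveAt_of_helperBandL {L T₀ δ θ : ℝ} (hθ : 0 < θ) (hS : MassAwareSamplingL L δ θ)
    (hcrit : ∀ κ₀ : ℝ, 0 < κ₀ → κ₀ < 1 / 2 → δ * Phi κ₀ < 8 * Real.pi * θ)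
    (hH : HelperBandL L T₀ δ) (hT : 2 * Real.pi * Real.exp (2 * Real.pi) ≤ T₀) : OffLineScreenedAboveAt T₀ 1 := by
  intro ρ hρ hre hτ
  have hre1 : ρ.re < 1 := (mem_riemannZetaNontrivialZeros_iff_holds.1 hρ).2.2
  set κ₀ : ℝ := ρ.re - 1 / 2 with hκ₀def
  have hκ₀ : 0 < κ₀ := by rw [hκ₀def]; linarith
  have hκ₀' : κ₀ < 1 / 2 := by rw [hκ₀def]; linarith
  set D : ℝ := zdens ρ.im with hDdef
  have hπ : 0 < 2 * Real.pi := by positivity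
  have him : 0 < ρ.im := by
    have : 0 < 2 * Real.pi * Real.exp (2 * Real.pi) := by positivity
    linarith
  have hD : 1 ≤ D := by
    have h0 : 2 * Real.pi * Real.exp (2 * Real.pi) < ρ.im := lt_of_le_of_lt hT hτ
    have h1 : Real.exp (2 * Real.pi) ≤ ρ.im / (2 * Real.pi) := by
      rw [le_div_iff₀ hπ]; linarith
    have h2 : 2 * Real.pi ≤ Real.log (ρ.im / (2 * Real.pi)) := by
      have := Real.log_le_log (Real.exp_pos _) h1
      rwa [Real.log_exp] at this
    rw [hDdef, zdens, le_div_iff₀ hπ]; linarith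
  have hDpos : 0 < D := by linarith
  -- the relative slack ε
  obtain ⟨ε, hε, hmain⟩ : ∃ ε : ℝ, 0 < ε ∧ (1 + ε) * (δ * Phi κ₀) < 8 * Real.pi * θ := by
    have hlt := hcrit κ₀ hκ₀ hκ₀'
    obtain ⟨X, hXdef⟩ : ∃ X : ℝ, X = δ * Phi κ₀ := ⟨_, rfl⟩
    rw [← hXdef] at hlt ⊢
    by_cases hpos : 0 < X
    · refine ⟨(8 * Real.pi * θ - X) / (2 * X), div_pos (by linarith) (by linarith), ?_⟩
      have hX0 : X ≠ 0 := hpos.ne'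
      have hid : (1 + (8 * Real.pi * θ - X) / (2 * X)) * X = (X + 8 * Real.pi * θ) / 2 := by
        field_simp
        ring
      rw [hid]
      linarith
    · have hpos' : X ≤ 0 := not_lt.mp hpos
      have h8 : 0 < 8 * Real.pi * θ := by positivity
      exact ⟨1, one_pos, by linarith⟩
  -- sampling lemma (its window is within the cap the zeros supply) and helper band
  obtain ⟨Λ, hΛ, hΛcap, hsyn⟩ := hS ε hε κ₀ hκ₀ hκ₀' D hD
  have hcap : Λ ≤ ρ.im / (8 * Real.pi) := by
    rw [hDdef, exp_two_pi_mul_zdens him] at hΛcap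
    have : ρ.im / (2 * Real.pi) / 4 = ρ.im / (8 * Real.pi) := by ring
    linarith [this]
  obtain ⟨N₀, hN₀⟩ := hH ρ hρ hre hτ Λ hΛ hcap
  refine ⟨N₀, fun N hN ↦ ?_⟩
  obtain ⟨j₀, hj₀, n, s, hinj, hright, hother, hm₀, hband⟩ := hN₀ N hN
  have hj : (j₀ : ZeroIdx).OffLine := by
    show (j₀ : ZeroIdx).val.re ≠ 1 / 2
    rw [hj₀]; exact ne_of_gt hre
  have hkap0 : kap j₀ = κ₀ := by rw [hκ₀def, kap, hj₀]
  have hw : ∀ k, 0 < hwt (s k) := fun k ↦ hwt_pos (s k)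
  have hk : ∀ k, 0 ≤ hkap (s k) ∧ hkap (s k) < 1 / 2 := fun k ↦ hkap_range (s k) (hright k)
  have hw₀ : (0 : ℝ) ≤ 2 * ((fib j₀).card : ℝ) := by positivity
  obtain ⟨b, hb⟩ := hsyn n (fun k ↦ tau (s k) - tau j₀) (fun k ↦ hwt (s k)) (fun k ↦ hkap (s k))
    (2 * ((fib j₀).card : ℝ)) hw₀ hm₀ hw hk hband
  -- rewrite the lemma's output in the form of T8b (ridge level 1)
  simp_rw [← hmul_eq] at hb
  have hle : (∫ u in Icc (-1 : ℝ) 1, ‖2 * (Real.sinh (kap j₀ * u) : ℂ) -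
      ∑ k, b k * hmul (s k) u * cexp (-(I * ((tau (s k) - tau j₀ : ℝ) : ℂ) * u))‖ ^ 2) +
      1 * ∑ k, ‖b k‖ ^ 2 / hwt (s k) ≤ 1 * ((1 + ε) * Phi κ₀ / (2 * Real.pi * θ * D)) := by
    rw [hkap0, one_mul, one_mul]; exact hb
  -- the budget inequality m₀·Q < 2
  have hcard : (0 : ℝ) < (fib j₀).card := by exact_mod_cast fib_card_pos j₀
  have hQ : ((fib j₀).card : ℝ) * ((1 + ε) * Phi κ₀ / (2 * Real.pi * θ * D)) < 2 := by
    have hden : 0 < 2 * Real.pi * θ * D := by positivity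
    by_cases hΦ : 0 ≤ Phi κ₀
    · have hQnn : 0 ≤ (1 + ε) * Phi κ₀ / (2 * Real.pi * θ * D) := by positivity
      calc ((fib j₀).card : ℝ) * ((1 + ε) * Phi κ₀ / (2 * Real.pi * θ * D))
          ≤ (δ * D / 2) * ((1 + ε) * Phi κ₀ / (2 * Real.pi * θ * D)) :=
            mul_le_mul_of_nonneg_right (by linarith) hQnn
        _ = ((1 + ε) * (δ * Phi κ₀)) / (4 * Real.pi * θ) := by
            field_simp
            ring
        _ < 2 := by
            rw [div_lt_iff₀ (by positivity)]
            linarith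
    · have hΦ' : Phi κ₀ < 0 := not_le.mp hΦ
      have h1 : (1 + ε) * Phi κ₀ / (2 * Real.pi * θ * D) < 0 :=
        div_neg_of_neg_of_pos (by nlinarith) hden
      nlinarith
  exact synth_negRoot_normalised hj hinj hright hother b one_pos hle hQ

/-- Row **X-7♮_L**: `MassAwareSamplingL L δ θ ∧ (δ·Φ < 8πθ on (0,½)) ∧ HelperBandL L T₀ δ ∧ T₀ ≥ 2π e^{2π}` ⟹ `RH ⟺ RH(T₀) ∧ B′₁([−1,1])`.
[new; conditional bookkeeping] -/
theorem rh_iff_rhUpTo_and_boundedAwayAt_of_samplingL {L T₀ δ θ : ℝ} (hθ : 0 < θ) (hS : MassAwareSamplingL L δ θ)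
    (hcrit : ∀ κ₀ : ℝ, 0 < κ₀ → κ₀ < 1 / 2 → δ * Phi κ₀ < 8 * Real.pi * θ)
    (hH : HelperBandL L T₀ δ) (hT : 2 * Real.pi * Real.exp (2 * Real.pi) ≤ T₀) :
    _root_.RiemannHypothesis ↔
      RiemannHypothesisUpTo T₀ ∧ TruncNegEigenvalueBoundedAwayAt (Icc (-1 : ℝ) 1) 1 :=
  rh_iff_rhUpTo_and_boundedAwayAt (offLineScreenedAboveAt_of_helperBandL hθ hS hcrit hH hT)

/-- **ORDINATE BAND above `T₀` at width `δ` with WINDOW CAP `L`**: `OrdinateBand` with `b − a ≤ 4` replaced by `b − a ≤ L`.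
[new; typed hypothesis, discharged below from HSW] -/
def OrdinateBandL (L T₀ δ : ℝ) : Prop :=
  ∀ τ₀ : ℝ, T₀ < τ₀ → ∀ Λ : ℝ, 0 < Λ → Λ ≤ τ₀ / (8 * Real.pi) → ∃ N₀ : ℕ, ∀ N : ℕ, N₀ ≤ N →
    ∀ a b : ℝ, -Λ ≤ a → a < b → b ≤ Λ → b - a ≤ L →
      |((((Finset.univ : Finset (truncIdx N)).filter (fun i ↦ a < tau i - τ₀ ∧ tau i - τ₀ ≤ b)).card : ℕ) : ℝ) -
          zdens τ₀ * (b - a)| ≤ δ * zdens τ₀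

/-- **(K-comb_L) `OrdinateBandL L T₀ δ → HelperBandL L T₀ δ`** for caps `L ≥ 4` (G8.8 with the window cap as a parameter; proof verbatim —
the bound `2m₀ ≤ δ·D` reads the band on `(−η, η]`, `η ≤ 2`, a window of length `≤ 4 ≤ L`): the helper family is one right representative per key of `Γ_N` other than the
target's; its weighted local band IS the slot count (fiberwise over keys), and `2m₀ ≤ δ·D` is the band on `(−η, η]`, `η ↓ 0`. [new; unconditional] -/
theorem helperBandL_of_ordinateBandL {L T₀ δ : ℝ} (hL : 4 ≤ L) (h : OrdinateBandL L T₀ δ) : HelperBandL L T₀ δ := by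
  intro ρ hρ hre hτ Λ hΛ hΛcap
  obtain ⟨N₀, hN₀⟩ := h ρ.im hτ Λ hΛ hΛcap
  obtain ⟨i₀, hi₀⟩ := exists_slot hρ
  refine ⟨max N₀ ⌈‖ρ - 1 / 2‖⌉₊, fun N hN ↦ ?_⟩
  have hN₀N : N₀ ≤ N := le_trans (le_max_left _ _) hN
  have hceil : (⌈‖ρ - 1 / 2‖⌉₊ : ℝ) ≤ N := by exact_mod_cast le_trans (le_max_right N₀ _) hN
  have hi₀N : i₀ ∈ truncIdx N := mem_truncIdx_of_le (by rw [hi₀]; exact (Nat.le_ceil _).trans hceil)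
  obtain ⟨j₀, hj₀⟩ : ∃ j₀ : truncIdx N, ((j₀ : truncIdx N) : ZeroIdx).val = ρ := ⟨⟨i₀, hi₀N⟩, hi₀⟩
  have hj : (j₀ : ZeroIdx).OffLine := by
    show (j₀ : ZeroIdx).val.re ≠ 1 / 2
    rw [hj₀]; exact ne_of_gt hre
  have hj₀re : 1 / 2 ≤ ((j₀ : truncIdx N) : ZeroIdx).val.re := by rw [hj₀]; exact hre.le
  have htau0 : tau j₀ = ρ.im := by unfold tau; rw [hj₀]
  have hband := hN₀ N hN₀N
  -- keys other than `ρ`, enumerated by `Fin n`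
  set K : Finset ℂ := ((Finset.univ : Finset (truncIdx N)).filter (fun i ↦ key i ≠ ρ)).image key with hKdef
  have hKmem : ∀ w ∈ K, ∃ i : truncIdx N, key i ≠ ρ ∧ key i = w := fun w hw ↦ by
    obtain ⟨i, hi, rfl⟩ := Finset.mem_image.1 hw
    exact ⟨i, (Finset.mem_filter.1 hi).2, rfl⟩
  choose pick hpick_ne hpick_eq using hKmem
  have hρK : ρ ∉ K := fun hK ↦ hpick_ne ρ hK (hpick_eq ρ hK)
  set n : ℕ := K.card with hndef
  set e := K.equivFin with hedef
  set z : Fin n → ℂ := fun k ↦ ((e.symm k : K) : ℂ) with hzdef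
  have hzK : ∀ k, z k ∈ K := fun k ↦ (e.symm k).2
  set s : Fin n → truncIdx N := fun k ↦ rrep (pick (z k) (hzK k)) with hsdef
  have hsval : ∀ k, ((s k : truncIdx N) : ZeroIdx).val = z k := fun k ↦ by
    rw [hsdef]
    show ((rrep (pick (z k) (hzK k)) : truncIdx N) : ZeroIdx).val = z k
    rw [val_rrep, hpick_eq (z k) (hzK k)]
  have hsre : ∀ k, 1 / 2 ≤ ((s k : truncIdx N) : ZeroIdx).val.re := fun k ↦ by
    rw [hsdef]
    show 1 / 2 ≤ ((rrep (pick (z k) (hzK k)) : truncIdx N) : ZeroIdx).val.re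
    rw [val_rrep]; exact key_re _
  have hzne : ∀ k, z k ≠ ρ := fun k ↦ by
    rw [← hpick_eq (z k) (hzK k)]; exact hpick_ne (z k) (hzK k)
  have htauk : ∀ k, tau (s k) = (z k).im := fun k ↦ by unfold tau; rw [hsval k]
  refine ⟨j₀, hj₀, n, s, ?_, ?_, ?_, ?_, ?_⟩
  · -- different helpers carry different zeros
    intro k l hkl
    rw [hsval, hsval] at hkl
    exact e.symm.injective (Subtype.ext hkl)
  · -- off-line helpers are right of the line
    intro k hoff
    exact lt_of_le_of_ne (hsre k) (fun h' ↦ hoff h'.symm)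
  · -- no helper in the target's classes
    intro k
    refine ⟨?_, ?_⟩
    · rw [hsval, hj₀]; exact hzne k
    · rw [hsval, val_tbar, hj₀]
      intro h'
      have h1 := congrArg Complex.re h'
      simp at h1
      have h2 := hsre k
      rw [hsval] at h2
      linarith
  · -- 2 m₀ ≤ δ·D from the band on (−η, η]
    have hm : ∀ η : ℝ, 0 < η → η ≤ Λ → η ≤ 2 →
        2 * ((fib j₀).card : ℝ) ≤ zdens ρ.im * (2 * η) + δ * zdens ρ.im := by
      intro η hη hηΛ hη2
      have hb := hband (-η) η (by linarith) (by linarith) hηΛ (by linarith)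
      have hsub : fib j₀ ∪ fib (tbar j₀) ⊆
          (Finset.univ : Finset (truncIdx N)).filter (fun i ↦ -η < tau i - ρ.im ∧ tau i - ρ.im ≤ η) := by
        intro i hi
        rw [Finset.mem_union, mem_fib, mem_fib, val_tbar, hj₀] at hi
        have htau : tau i = ρ.im := by
          unfold tau
          rcases hi with h1 | h1 <;> simp [h1]
        simp only [Finset.mem_filter, Finset.mem_univ, true_and, htau]
        constructor <;> linarith
      have hcard := Finset.card_le_card hsub
      rw [Finset.card_union_of_disjoint (Finset.disjoint_left.2 fun x hx hx' ↦ not_mem_fib_tbar_of_mem hj hx hx'),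
        card_fib_tbar] at hcard
      have hc' : 2 * ((fib j₀).card : ℝ) ≤
          ((((Finset.univ : Finset (truncIdx N)).filter (fun i ↦ -η < tau i - ρ.im ∧ tau i - ρ.im ≤ η)).card : ℕ) : ℝ) := by
        have : 2 * (fib j₀).card ≤
            ((Finset.univ : Finset (truncIdx N)).filter (fun i ↦ -η < tau i - ρ.im ∧ tau i - ρ.im ≤ η)).card := by omega
        exact_mod_cast this
      have h3 := (abs_le.1 hb).2
      have h4 : zdens ρ.im * (η - -η) = zdens ρ.im * (2 * η) := by ring
      linarith
    rcases le_or_gt (zdens ρ.im) 0 with hD | hD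
    · have := hm (min Λ 2) (lt_min hΛ two_pos) (min_le_left _ _) (min_le_right _ _)
      have h5 : zdens ρ.im * (2 * min Λ 2) ≤ 0 :=
        mul_nonpos_of_nonpos_of_nonneg hD (by positivity)
      linarith
    · by_contra hcon
      have hcon' := not_le.mp hcon
      set η : ℝ := min (min Λ 2) ((2 * ((fib j₀).card : ℝ) - δ * zdens ρ.im) / (4 * zdens ρ.im)) with hηdef
      have hηpos : 0 < η := lt_min (lt_min hΛ two_pos) (div_pos (by linarith) (by linarith))
      have h6 := hm η hηpos ((min_le_left _ _).trans (min_le_left _ _)) ((min_le_left _ _).trans (min_le_right _ _))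
      have h7 : η ≤ (2 * ((fib j₀).card : ℝ) - δ * zdens ρ.im) / (4 * zdens ρ.im) := min_le_right _ _
      have h8 : zdens ρ.im * (2 * η) ≤ (2 * ((fib j₀).card : ℝ) - δ * zdens ρ.im) / 2 := by
        have := mul_le_mul_of_nonneg_left h7 (by linarith : (0 : ℝ) ≤ 2 * zdens ρ.im)
        have h9 : 2 * zdens ρ.im * ((2 * ((fib j₀).card : ℝ) - δ * zdens ρ.im) / (4 * zdens ρ.im)) =
            (2 * ((fib j₀).card : ℝ) - δ * zdens ρ.im) / 2 := by
          field_simp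
          ring
        nlinarith
      linarith
  · -- the local band of the helper family IS the slot count
    intro a b ha hab hb hlen
    have hb' := hband a b ha hab hb hlen
    set P : Finset (truncIdx N) :=
      (Finset.univ : Finset (truncIdx N)).filter (fun i ↦ a < tau i - ρ.im ∧ tau i - ρ.im ≤ b) with hPdef
    -- fibres over keys
    have hHt : ∀ i ∈ P, key i ∈ insert ρ K := by
      intro i _
      by_cases hk : key i = ρ
      · rw [hk]; exact Finset.mem_insert_self _ _
      · exact Finset.mem_insert_of_mem (Finset.mem_image_of_mem _ (Finset.mem_filter.2 ⟨Finset.mem_univ _, hk⟩))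
    have hfib : P.card = ∑ w ∈ insert ρ K, (P.filter (fun i ↦ key i = w)).card :=
      Finset.card_eq_sum_card_fiberwise hHt
    rw [Finset.sum_insert hρK] at hfib
    have hfibre : ∀ w : ℂ, (P.filter (fun i ↦ key i = w)).card =
        if a < w.im - ρ.im ∧ w.im - ρ.im ≤ b then
          ((Finset.univ : Finset (truncIdx N)).filter (fun i ↦ key i = w)).card else 0 := by
      intro w
      split_ifs with hw
      · congr 1
        ext i
        simp only [hPdef, Finset.mem_filter, Finset.mem_univ, true_and]
        constructor
        · rintro ⟨_, h2⟩; exact h2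
        · intro h2
          refine ⟨?_, h2⟩
          rw [← key_im, h2]; exact hw
      · rw [Finset.card_eq_zero, Finset.filter_eq_empty_iff]
        intro i hi h2
        apply hw
        rw [hPdef, Finset.mem_filter] at hi
        rw [← h2, key_im]; exact hi.2
    -- the ρ-fibre is the virtual atom
    have hρfib : (((P.filter (fun i ↦ key i = ρ)).card : ℕ) : ℝ) =
        if a < 0 ∧ 0 ≤ b then 2 * ((fib j₀).card : ℝ) else 0 := by
      rw [hfibre ρ, sub_self]
      by_cases h0 : a < 0 ∧ 0 ≤ b
      · rw [if_pos h0, if_pos h0, ← hj₀, card_filter_key_eq hj₀re]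
        unfold hwt
        rw [if_pos hj]
      · rw [if_neg h0, if_neg h0]
        simp
    -- the K-fibres are the helper sum
    have hKsum : (((∑ w ∈ K, (P.filter (fun i ↦ key i = w)).card : ℕ)) : ℝ) =
        ∑ k ∈ Finset.univ.filter (fun k ↦ a < tau (s k) - tau j₀ ∧ tau (s k) - tau j₀ ≤ b), hwt (s k) := by
      rw [Nat.cast_sum, Finset.sum_filter, ← Finset.sum_coe_sort K, ← Equiv.sum_comp e.symm]
      refine Finset.sum_congr rfl fun k _ ↦ ?_
      have hzk : ((e.symm k : K) : ℂ) = z k := rfl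
      rw [hzk, hfibre (z k), htauk k, htau0]
      by_cases hc : a < (z k).im - ρ.im ∧ (z k).im - ρ.im ≤ b
      · rw [if_pos hc, if_pos hc, ← hsval k, card_filter_key_eq (hsre k)]
      · rw [if_neg hc, if_neg hc]
        simp
    have hid : (∑ k ∈ Finset.univ.filter (fun k ↦ a < tau (s k) - tau j₀ ∧ tau (s k) - tau j₀ ≤ b), hwt (s k)) +
        (if a < 0 ∧ 0 ≤ b then 2 * ((fib j₀).card : ℝ) else 0) = ((P.card : ℕ) : ℝ) := by
      rw [hfib, Nat.cast_add, hρfib, hKsum]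
      ring
    rw [hid]
    exact hb'

/-- Row **X-7♮♮_L**: `MassAwareSamplingL L δ θ ∧ (δ·Φ < 8πθ) ∧ OrdinateBandL L T₀ δ ∧ T₀ ≥ 2π e^{2π}` ⟹ `RH ⟺ RH(T₀) ∧ B′₁([−1,1])`.
[new; conditional bookkeeping] -/
theorem rh_iff_rhUpTo_and_boundedAwayAt_of_ordinateBandL {L T₀ δ θ : ℝ} (hL : 4 ≤ L) (hθ : 0 < θ) (hS : MassAwareSamplingL L δ θ)
    (hcrit : ∀ κ₀ : ℝ, 0 < κ₀ → κ₀ < 1 / 2 → δ * Phi κ₀ < 8 * Real.pi * θ)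
    (hO : OrdinateBandL L T₀ δ) (hT : 2 * Real.pi * Real.exp (2 * Real.pi) ≤ T₀) :
    _root_.RiemannHypothesis ↔
      RiemannHypothesisUpTo T₀ ∧ TruncNegEigenvalueBoundedAwayAt (Icc (-1 : ℝ) 1) 1 :=
  rh_iff_rhUpTo_and_boundedAwayAt_of_samplingL hθ hS hcrit (helperBandL_of_ordinateBandL hL hO) hT


end Summit.RiemannHypothesis.RiemannHypothesis.Theorems.Splittings.XWucG8

end
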